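import Summits.SmoothPoincare4.SmoothPoincare4.Theorems.CylinderEntropyCylinderRungTwoKillingFluxDefs
import Summits.SmoothPoincare4.SmoothPoincare4.Theorems.CylinderEntropyImmortalAreaToFloorOfSmallTilt
import Summits.SmoothPoincare4.SmoothPoincare4.Theorems.CylinderEntropyCylinderRungTwoParabolicAreaFloor
import Summits.SmoothPoincare4.SmoothPoincare4.Theorems.CylinderEntropyCylinderRungTwoDissipationBudget
import Summits.SmoothPoincare4.SmoothPoincare4.Theorems.CylinderEntropyCylinderRungTwoAreaToFloorOfQuantization
import Summits.SmoothPoincare4.SmoothPoincare4.Theorems.CylinderEntropyCylinderRungTwoTiltExcessVanishing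
import HarnessLib

/-!
# Route `CylinderEntropy`, crux `CylinderRungTwo` (stmt-SmoothPoincare4-7631), line `killing-flux`:
# NULL SURVIVORS DIE ⇐ ONE STATIC DEGREE-ZERO LEMMA (lead reshape r18)

Registered helper `helper_nullSurvivorsDieOfStatic` (lead c7).  The registered stub `stub_nullSurvivorsDie` of the
checked skeleton `Cruxes/CylinderRungTwo/Lines/killing_flux.lean` (r17b) is a FLOW statement: there is no immortal
smooth mean curvature flow `IsCylinderMCF P F ν T` of a compact connected cross-section of `N = S⁴ × ℝ ⊂ ℝ⁶` with
cylinder entropy `λ_cyl < 2` along the flow whose slices never separate the two ends of `N` and carry zero vertical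
flux `∫ ν₅ d((F t)^*μH⁴) = 0`.  This file PROVES that it follows from ONE static, flow-free, entropy-using lemma —
the DEGREE-ZERO TWIN of the residual `areaNearFloorOfSmallTilt` of the route crux `ImmortalAreaToFloor`
(stmt-SmoothPoincare4-17197, `Theorems/CylinderEntropyImmortalAreaToFloorOfSmallTilt.lean`):

* **`NullThinStatic`** (hypothesis `hstatic`, the new registered stub `stub_nullThinStatic` of the skeleton): for every
  entropy gap `δ > 0` and height bound `B` there is `ε > 0` such that NO compact connected embedded cross-section
  `ι : M → N` with smooth unit normal `ν` tangent to `N`, NOT separating the ends, with `|z₅| ≤ B`,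
  `λ_cyl(ι M) ≤ 2 - δ`, AREA AT LEAST THE FLOOR `μH⁴(S⁴) ≤ μH⁴(ι M)`, tilt excess `∫ (1 - ν₅²) d(ι^*μH⁴) ≤ ε`,
  Willmore energy `∫ H² d(ι^*μH⁴) ≤ ε` and ZERO VERTICAL FLUX `∫ ν₅ d(ι^*μH⁴) = 0` exists.
  (Why true, informally: such a sequence with `ε → 0` has varifold limit a stationary integral varifold of `N` of
  mass in `[vol, (2-δ) vol]`, horizontal by the first variation along `φ(z₅) e₅`, hence ONE slice with multiplicity
  ONE; a tilt-free degree-zero (`flux = 0`) family cannot converge with multiplicity one to a slice while keeping the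
  typed densities `≤ 2 - δ` at the thickness scale of its cancelling sheets.  It is the `d = 0` case of the degree
  form "area `≈ |d| · vol`" of 17197's static lemma and is NOT provable by citation: Allard's regularity needs
  `H ∈ L^p`, `p > 4`.)
* **`helper_nullSurvivorsDieOfStatic : NullThinStatic → stub_nullSurvivorsDie`** — the reduction, over landed
  theorems only: the uniform entropy gap along the flow (`IsCylinderMCF.exists_cylEntropy_le_ofReal_two_sub`,
  Hamilton's monotonicity), the uniform height bound (`IsCylinderMCF.exists_height_bound`, slab confinement), good
  times from the dissipation budget (`stub_dissipationBudget`, `exists_lt_of_setLIntegral_le`) with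
  `∫ ‖∂_r F‖² = ∫ H² → 0` (`IsCylinderMCF.norm_deriv_sq`) while the antitone finite areas converge
  (`stub_areaDissipation`, `IsCylinderMCF.measure_range_lt_two_mul`), the tilt excess tending to `0` along them
  (`tendsto_lintegral_tiltExcess_comap`), and THE PARABOLIC AREA FLOOR `helper_volLeAreaAlongCylinderFlow`
  (`μH⁴(S⁴) ≤ μH⁴(F_t P)` along every immortal cylinder flow of a non-empty closed cross-section — this is where
  immortality is consumed); at a good time with tilt `≤ ε` and `∫ H² ≤ ε` the static lemma applies to that slice,
  whose flux is `0` and which does not separate by hypothesis.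

So after r18 the two GMT residuals of line `killing-flux` — `stub_areaToFloor` (= 17197, degree `±1`) and
`stub_nullThinStatic` (degree `0`) — are two STATIC lemmas of one family, and nothing here is conditional: no
`sorry`, no new definition, no named fact.

References: R. S. Hamilton, *Monotonicity formulas for parabolic flows on manifolds*, Comm. Anal. Geom. 1 (1993)
127–137, Thm. 4.1; K. Brakke, *The motion of a surface by its mean curvature* (1978), §3 (area as a Lyapunov
function); W. K. Allard, *On the first variation of a varifold*, Ann. of Math. 95 (1972), Thm. 6.4 and §8 (why
the static lemma is of compactness-and-regularity type).
-/

noncomputable section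

-- the prescribed namespace `Summit.SmoothPoincare4.SmoothPoincare4.…` repeats `SmoothPoincare4`
set_option linter.dupNamespace false

open MeasureTheory Set Filter
open scoped Manifold ContDiff ENNReal Topology BigOperators

namespace Summit.SmoothPoincare4.SmoothPoincare4.Cruxes.CylinderRungTwo.KillingFlux

open Literature.Geometry.Riemannian
open Literature.Geometry.Lorentzian Literature.Geometry.Lorentzian.PseudoRiemannianMetric
open Literature.Geometry.Riemannian.SphericalCylinderEntropy

/-- **Registered helper `helper_nullSurvivorsDieOfStatic` (lead reshape r18 of line `killing-flux`): NULL
SURVIVORS DIE from the static degree-zero lemma.**  Hypothesis (`stub_nullThinStatic` of the skeleton, verbatim):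
for every `δ > 0` and `B` there is `ε > 0` such that no compact connected embedded non-separating cross-section
`ι : M → N` with smooth unit normal `ν` tangent to `N`, `|z₅| ≤ B`, `λ_cyl(ι M) ≤ 2 - δ`, `μH⁴(S⁴) ≤ μH⁴(ι M)`,
tilt excess `≤ ε`, `∫ H² ≤ ε` and vertical flux `∫ ν₅ d(ι^*μH⁴) = 0` exists.  Conclusion (`stub_nullSurvivorsDie`
of the skeleton, verbatim): there is no immortal smooth cylinder flow of a compact connected cross-section with
`λ_cyl < 2` along the flow whose slices never separate the ends and have zero vertical flux.  Proof: uniform gap,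
uniform height bound, good times `r_n → ∞` with `∫ H² → 0` and convergent areas from the dissipation budget, tilt
excess `→ 0` along them, the parabolic area floor at every time, and `hstatic` at a good time.
[cite: Hamilton1993, Thm. 4.1] [cite: Brakke1978, §3] -/
theorem helper_nullSurvivorsDieOfStatic :
    (∀ δ : ℝ, 0 < δ → ∀ B : ℝ, ∃ ε : ℝ, 0 < ε ∧
      ∀ (M : Type) [TopologicalSpace M] [T2Space M] [SecondCountableTopology M]
        [ChartedSpace (EuclideanSpace ℝ (Fin 4)) M] [IsManifold (𝓡 4) ∞ M] [CompactSpace M]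
        [ConnectedSpace M] [MeasurableSpace M] [BorelSpace M]
        (ι ν : M → EuclideanSpace ℝ (Fin 6)),
        Manifold.IsSmoothEmbedding (𝓡 4) (𝓡 6) ∞ ι →
        (∀ x, ∑ i : Fin 5, ι x (Fin.castSucc i) ^ 2 = 1) →
        ¬ SeparatesEnds (Set.range ι) →
        ∀ himm : (euclideanMetric (EuclideanSpace ℝ (Fin 6))).IsSpacelikeImmersion (𝓡 4) ι,
        (euclideanMetric (EuclideanSpace ℝ (Fin 6))).IsUnitNormal (𝓡 4) ι ν 1 →
        (∀ x, ∑ i : Fin 5, ν x (Fin.castSucc i) * ι x (Fin.castSucc i) = 0) →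
        ContMDiff (𝓡 4) (𝓡 6) ∞ ν →
        (∀ x, |ι x 5| ≤ B) →
        cylEntropy (Set.range ι) ≤ ENNReal.ofReal (2 - δ) →
        μH[4] (Metric.sphere (0 : EuclideanSpace ℝ (Fin 5)) 1) ≤ μH[4] (Set.range ι) →
        ∫⁻ x, ENNReal.ofReal (1 - ν x 5 ^ 2)
            ∂(Measure.comap ι (μH[4] : Measure (EuclideanSpace ℝ (Fin 6)))) ≤ ENNReal.ofReal ε →
        ∫⁻ x, ENNReal.ofReal
            ((euclideanMetric (EuclideanSpace ℝ (Fin 6))).meanCurvature ι contMDiff_pullbackBilin_holds himm ν x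
              ^ 2) ∂(Measure.comap ι (μH[4] : Measure (EuclideanSpace ℝ (Fin 6)))) ≤ ENNReal.ofReal ε →
        ∫ x, ν x 5 ∂(Measure.comap ι (μH[4] : Measure (EuclideanSpace ℝ (Fin 6)))) = 0 →
        False) →
    ¬ ∃ (P : Type) (_ : TopologicalSpace P) (_ : T2Space P) (_ : SecondCountableTopology P)
        (_ : ChartedSpace (EuclideanSpace ℝ (Fin 4)) P) (_ : IsManifold (𝓡 4) ∞ P) (_ : CompactSpace P)
        (_ : ConnectedSpace P) (_ : MeasurableSpace P) (_ : BorelSpace P)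
        (F : ℝ → P → EuclideanSpace ℝ (Fin 6)) (ν : ℝ → P → EuclideanSpace ℝ (Fin 6)) (T : ℝ),
        IsCylinderMCF P F ν T ∧ (∀ t, T ≤ t → cylEntropy (Set.range (F t)) < 2) ∧
          (∀ t, T ≤ t → ¬ SeparatesEnds (Set.range (F t))) ∧
          (∀ t, T ≤ t → ∫ x, ν t x 5 ∂(Measure.comap (F t) (μH[4] : Measure (EuclideanSpace ℝ (Fin 6)))) = 0) := by
  rintro hstatic ⟨P, _, _, _, _, _, _, _, _, _, F, ν, T, hflow, hent, hnsep, hflux⟩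
  -- uniform entropy gap, uniform height bound, and the static threshold
  obtain ⟨δ, hδ, hgap⟩ := hflow.exists_cylEntropy_le_ofReal_two_sub (hent T le_rfl)
  obtain ⟨B, hB⟩ := hflow.exists_height_bound
  obtain ⟨ε₁, hε₁, hstat⟩ := hstatic δ hδ B
  -- the areas: antitone, finite
  set V : ℝ≥0∞ := μH[4] (Metric.sphere (0 : EuclideanSpace ℝ (Fin 5)) 1) with hV
  set a : ℝ → ℝ≥0∞ := fun t => μH[4] (Set.range (F t)) with ha
  set Ainf : ℝ≥0∞ := ⨅ t ∈ Set.Ici T, a t with hAinf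
  have haT : a T < 2 * V := hflow.measure_range_lt_two_mul le_rfl (hent T le_rfl)
  have haTtop : a T ≠ ⊤ := ne_top_of_lt haT
  have hanti : AntitoneOn a (Set.Ici T) := stub_areaDissipation P F ν T hflow
  have hAinf_le : ∀ t, T ≤ t → Ainf ≤ a t := fun t ht => iInf₂_le t (Set.mem_Ici.2 ht)
  have hAinf_top : Ainf < ⊤ := lt_of_le_of_lt (hAinf_le T le_rfl) (lt_top_iff_ne_top.2 haTtop)
  -- the speed integral and its budget
  set f : ℝ → ℝ≥0∞ := fun r => ∫⁻ x, ENNReal.ofReal (‖deriv (fun s => F s x) r‖ ^ 2)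
      ∂(Measure.comap (F r) (μH[4] : Measure (EuclideanSpace ℝ (Fin 6)))) with hf
  have hbudget : ∀ t, T ≤ t → ∫⁻ r in Set.Icc T t, f r ≤ a T := fun t ht =>
    le_trans le_self_add (stub_dissipationBudget P F ν T hflow t ht)
  -- small speed at arbitrarily late times
  have hsmall : ∀ n : ℕ, ∃ r : ℝ, T + n ≤ r ∧ f r < ENNReal.ofReal (1 / ((n : ℝ) + 1)) := by
    intro n
    refine exists_lt_of_setLIntegral_le (t₀ := T + n) haTtop (fun L hL => ?_) (by positivity)
    have hn : (0 : ℝ) ≤ n := Nat.cast_nonneg n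
    calc ∫⁻ r in Set.Icc (T + n) (T + n + L), f r ≤ ∫⁻ r in Set.Icc T (T + n + L), f r :=
          lintegral_mono_set (Set.Icc_subset_Icc_left (by linarith))
      _ ≤ a T := hbudget _ (by linarith)
  choose r hrT hrf using hsmall
  have hr : ∀ n, T ≤ r n := fun n =>
    le_trans (le_add_of_nonneg_right (Nat.cast_nonneg n)) (hrT n)
  -- `f (r n) → 0`
  have hf0 : Tendsto (fun n => f (r n)) atTop (𝓝 0) := by
    have h1 : Tendsto (fun n : ℕ => ENNReal.ofReal (1 / ((n : ℝ) + 1))) atTop (𝓝 0) := by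
      rw [← ENNReal.ofReal_zero]
      exact ENNReal.tendsto_ofReal tendsto_one_div_add_atTop_nhds_zero_nat
    exact tendsto_of_tendsto_of_tendsto_of_le_of_le tendsto_const_nhds h1 (fun _ => bot_le)
      fun n => (hrf n).le
  -- `a (r n) → Ainf`
  have hrtop : Tendsto r atTop atTop := by
    refine tendsto_atTop_mono hrT ?_
    exact tendsto_atTop_add_const_left _ _ tendsto_natCast_atTop_atTop
  have haA : Tendsto (fun n => a (r n)) atTop (𝓝 Ainf) := by
    refine tendsto_order.2 ⟨fun b hb => Eventually.of_forall fun n => lt_of_lt_of_le hb (hAinf_le _ (hr n)),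
      fun b hb => ?_⟩
    obtain ⟨t₁, ht₁⟩ := iInf_lt_iff.1 hb
    obtain ⟨hT₁, hlt₁⟩ := iInf_lt_iff.1 ht₁
    filter_upwards [hrtop.eventually_ge_atTop t₁] with n hn
    exact lt_of_le_of_lt (hanti hT₁ (Set.mem_Ici.2 (hr n)) hn) hlt₁
  -- `∫ H² d((F (r n))^* μH⁴) → 0`
  have hH0 : Tendsto (fun n => ∫⁻ x, ENNReal.ofReal
      ((euclideanMetric (EuclideanSpace ℝ (Fin 6))).meanCurvature (F (r n)) contMDiff_pullbackBilin_holds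
        (hflow.isSpacelikeImmersion (r n) (hr n)) (ν (r n)) x ^ 2)
      ∂(Measure.comap (F (r n)) (μH[4] : Measure (EuclideanSpace ℝ (Fin 6))))) atTop (𝓝 0) := by
    refine hf0.congr fun n => ?_
    simp only [hf]
    refine lintegral_congr fun x => ?_
    rw [hflow.norm_deriv_sq (hr n) x]
  -- the tilt excess tends to `0` along the good times
  have htilt : Tendsto (fun n => ∫⁻ x, ENNReal.ofReal (1 - ν (r n) x 5 ^ 2)
      ∂(Measure.comap (F (r n)) (μH[4] : Measure (EuclideanSpace ℝ (Fin 6))))) atTop (𝓝 0) :=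
    tendsto_lintegral_tiltExcess_comap (fun n => (hflow.isSmoothEmbedding (r n) (hr n)).isEmbedding.injective)
      (fun n => hflow.isSpacelikeImmersion (r n) (hr n)) (fun n => hflow.contMDiff_normal (r n) (hr n))
      (fun n => hflow.isUnitNormal (r n) (hr n)) (fun n x => hflow.mem_cyl (r n) (hr n) x)
      (fun n x => hflow.normal_tangent (r n) (hr n) x) (fun n x => hB (r n) (hr n) x) hH0 hAinf_top haA
  -- a good time with tilt `< ε₁` and `∫ H² < ε₁`
  have hev₁ : ∀ᶠ n in atTop, ∫⁻ x, ENNReal.ofReal (1 - ν (r n) x 5 ^ 2)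
      ∂(Measure.comap (F (r n)) (μH[4] : Measure (EuclideanSpace ℝ (Fin 6)))) < ENNReal.ofReal ε₁ :=
    (tendsto_order.1 htilt).2 _ (ENNReal.ofReal_pos.2 hε₁)
  have hev₂ : ∀ᶠ n in atTop, ∫⁻ x, ENNReal.ofReal
      ((euclideanMetric (EuclideanSpace ℝ (Fin 6))).meanCurvature (F (r n)) contMDiff_pullbackBilin_holds
        (hflow.isSpacelikeImmersion (r n) (hr n)) (ν (r n)) x ^ 2)
      ∂(Measure.comap (F (r n)) (μH[4] : Measure (EuclideanSpace ℝ (Fin 6)))) < ENNReal.ofReal ε₁ :=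
    (tendsto_order.1 hH0).2 _ (ENNReal.ofReal_pos.2 hε₁)
  obtain ⟨n, hn₁, hn₂⟩ := (hev₁.and hev₂).exists
  -- the parabolic area floor at that time (immortality consumed here)
  have hfloor : μH[4] (Metric.sphere (0 : EuclideanSpace ℝ (Fin 5)) 1) ≤ μH[4] (Set.range (F (r n))) :=
    helper_volLeAreaAlongCylinderFlow P F ν T hflow (r n) (hr n)
  exact hstat P (F (r n)) (ν (r n)) (hflow.isSmoothEmbedding _ (hr n)) (hflow.mem_cyl _ (hr n))
    (hnsep _ (hr n)) (hflow.isSpacelikeImmersion _ (hr n)) (hflow.isUnitNormal _ (hr n))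
    (hflow.normal_tangent _ (hr n)) (hflow.contMDiff_normal _ (hr n)) (hB _ (hr n)) (hgap _ (hr n)) hfloor
    hn₁.le hn₂.le (hflux _ (hr n))

end Summit.SmoothPoincare4.SmoothPoincare4.Cruxes.CylinderRungTwo.KillingFlux

end
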